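import Summits.Ventures.LatticeQCDFlow.Exactness.IMHCertificateCalibration
import HarnessLib

/-!
# The normaliser bracket from two samples: proposals certify `Z` from below, a handful of exact target samples certify it from
# above (`E_π[min(1/w̃, B)] ≤ 1/Z`) — and with both the every-weight error bar of the flow sampler is fully empirical

HONEST FRAMING: exact (Metropolis-corrected) sampling algorithms for lattice gauge theory;
figures of merit are autocorrelation/cost numbers at stated couplings and volumes; no
continuum-physics claim.

Venture `LatticeQCDFlow` (cell pub-lqcd), topic `Exactness`; FANOUT row 30 (lean-1, GEN-41).  NEW WORK of the cell, sequel of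
GEN-41's `IMHCertificateCalibration` (every input of the every-weight Bernstein bar is measurable from the proposals given an upper
bound `Z_hi` on the normaliser `Z = E_q[w̃]`) and `HiddenSectorNoCertificateInputs` (no such upper bound can be certified from the
proposals).  The missing number comes from the OTHER side of the identity `Z·E_π[1/w̃] = q{w̃ > 0} ≤ 1`: exact TARGET samples — a
short run of any exact algorithm for `π` (conventional HMC, or the flow sampler itself once certified) — certify `Z` FROM ABOVE
through the bounded statistic `min(1/w̃, B)`, exactly as proposals certify it from below through `min(w̃, B)` (bridge-sampling
folklore, here as one-sided certificates).  Setting: `q` the proposal law, `w = w̃/Z` the positive normalised weight, `π = w·q`.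

* §1 **`target_integral_min_inv_le`** — `E_π[min(1/w̃, B)] ≤ 1/Z` for every cut `B ≥ 0`; `min_inv_mem_Icc` — `min(1/w̃, B) ∈ [0, B]`
  (Hoeffding-able from target samples); `normaliser_le_inv_of_le_target_mean` — `0 < b ≤ E_π[min(1/w̃, B)] ⇒ Z ≤ 1/b`;
  `integral_unnormalised_eq_normaliser` — `E_q[w̃] = Z`; `le_normaliser_of_le_proposal_mean` — `a ≤ E_q[min(w̃, B)] ⇒ a ≤ Z`.
* §2 **`crnLag_replicas_burnIn_bernstein_abs_target_twoSample`** — THE FULLY EMPIRICAL EVERY-WEIGHT BERNSTEIN BAR: with a certified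
  `a ≤ E_q[min(w̃, B)]` (`a > 0`, from proposals) and a certified `b ≤ E_π[min(1/w̃, B′)]` (`b > 0`, from target samples), the bar of
  `IMHCertificateCalibration.crnLag_replicas_burnIn_bernstein_abs_target_of_estimates` holds with the bracket `[Z_lo, Z_hi] = [a, 1/b]`:
  from `x` with `w̃(x) ≤ M·a`, for certified numbers `ĉ ≤ E_q[min(1, b·w̃)]`, `t̂ ≥ q{M·a < w̃}`, `ŝ ≤ E_q[w̃·1{w̃ ≤ M·a}]`,
  `P(|H̄_R − π f| ≥ ε + (c − a_f)(1 − b·ŝ + ρ̂^k)) ≤ 2·exp(−Rε²/(2(σ² + (c − a_f)ε/3))) + R·(t̂ + ρ̂^k)`, `ρ̂ = 1 − ĉ/max(1, M)`.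
Reading: every number in the certified error bar of the exact flow sampler is now either chosen (`R`, `k`, `M`, `ε`, the cuts) or
measured with its own one-sided Hoeffding bar — five bounded means, four under the flow and ONE under the target; the total risk is
the bar's plus the five calibration risks (union bound).  NOT CLAIMED: how many target samples are worth spending (a cost question);
anything for unbounded `f`.  No `sorry`, no new definitions, nothing cited as a fact.
-/

noncomputable section

namespace Summit.Ventures.LatticeQCDFlow.Exactness

open MeasureTheory ProbabilityTheory Function Finset Filter
open scoped _root_.ENNReal unitInterval Topology
open Summit.Ventures.LatticeQCDFlow.Scoring

variable {Ω : Type*} [MeasurableSpace Ω] {q : Measure Ω} [IsProbabilityMeasure q] {w : Ω → ℝ}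

/-! ## §1 The two one-sided certificates of the normaliser -/

section Bracket

variable {wt : Ω → ℝ} {Znorm : ℝ}

omit [IsProbabilityMeasure q] in
/-- **`E_π[min(1/w̃, B)] ≤ 1/Z`** (`π = w·q`, `w = w̃/Z`, `w̃ ≥ 0` measurable, `Z > 0`, `B ≥ 0`): on `{w̃ > 0}` the integrand times the
density is `min(1/w̃, B)·w̃/Z ≤ 1/Z`, and `π` does not charge `{w̃ = 0}`. [ours] -/
theorem target_integral_min_inv_le (hw : Measurable w) (hw0 : ∀ y, 0 < w y) (hwZ : ∀ y, w y = wt y / Znorm)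
    (hwt0 : ∀ y, 0 ≤ wt y) (hZ : 0 < Znorm) {B : ℝ} (hB : 0 ≤ B) [IsProbabilityMeasure q] :
    ∫ y, min (wt y)⁻¹ B ∂(q.withDensity fun y => ENNReal.ofReal (w y)) ≤ Znorm⁻¹ := by
  rw [integral_withDensity_eq_integral_toReal_smul hw.ennreal_ofReal (ae_of_all _ fun x => ENNReal.ofReal_lt_top)]
  have hpt : ∀ y, (ENNReal.ofReal (w y)).toReal • min (wt y)⁻¹ B ≤ Znorm⁻¹ := by
    intro y
    rw [ENNReal.toReal_ofReal (hw0 y).le, smul_eq_mul, hwZ y]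
    rcases eq_or_lt_of_le (hwt0 y) with h0 | hpos
    · rw [← h0]; simp [inv_nonneg.2 hZ.le]
    · calc wt y / Znorm * min (wt y)⁻¹ B ≤ wt y / Znorm * (wt y)⁻¹ :=
            mul_le_mul_of_nonneg_left (min_le_left _ _) (div_nonneg hpos.le hZ.le)
        _ = Znorm⁻¹ := by field_simp
  have hnn : ∀ y, 0 ≤ (ENNReal.ofReal (w y)).toReal • min (wt y)⁻¹ B := fun y =>
    smul_nonneg ENNReal.toReal_nonneg (le_min (inv_nonneg.2 (hwt0 y)) hB)
  calc ∫ y, (ENNReal.ofReal (w y)).toReal • min (wt y)⁻¹ B ∂q ≤ ∫ _, Znorm⁻¹ ∂q :=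
        integral_mono_of_nonneg (ae_of_all _ hnn) (integrable_const _) (ae_of_all _ hpt)
    _ = Znorm⁻¹ := by simp

omit [MeasurableSpace Ω] [IsProbabilityMeasure q] in
/-- `min(1/w̃, B) ∈ [0, B]` for `w̃ ≥ 0`, `B ≥ 0` — a bounded statistic of a target sample. [ours, bookkeeping] -/
theorem min_inv_mem_Icc (hwt0 : ∀ y, 0 ≤ wt y) {B : ℝ} (hB : 0 ≤ B) (y : Ω) : min (wt y)⁻¹ B ∈ Set.Icc (0 : ℝ) B :=
  ⟨le_min (inv_nonneg.2 (hwt0 y)) hB, min_le_right _ _⟩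

omit [IsProbabilityMeasure q] in
/-- **THE UPPER CERTIFICATE**: `0 < b ≤ E_π[min(1/w̃, B)] ⇒ Z ≤ 1/b`. [ours] -/
theorem normaliser_le_inv_of_le_target_mean (hw : Measurable w) (hw0 : ∀ y, 0 < w y)
    (hwZ : ∀ y, w y = wt y / Znorm) (hwt0 : ∀ y, 0 ≤ wt y) (hZ : 0 < Znorm) {B : ℝ} (hB : 0 ≤ B) [IsProbabilityMeasure q] {b : ℝ}
    (hb0 : 0 < b) (hb : b ≤ ∫ y, min (wt y)⁻¹ B ∂(q.withDensity fun y => ENNReal.ofReal (w y))) : Znorm ≤ b⁻¹ := by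
  exact (le_inv_comm₀ hb0 hZ).1 (hb.trans (target_integral_min_inv_le hw hw0 hwZ hwt0 hZ hB))

omit [IsProbabilityMeasure q] in
/-- `E_q[w̃] = Z` for the normalised `w = w̃/Z` (`π = w·q` a probability measure, `Z > 0`). [ours, bookkeeping] -/
theorem integral_unnormalised_eq_normaliser (hw : Measurable w) (hw0 : ∀ y, 0 < w y)
    [IsProbabilityMeasure (q.withDensity fun y => ENNReal.ofReal (w y))] (hwZ : ∀ y, w y = wt y / Znorm) (hZ : 0 < Znorm) :
    ∫ y, wt y ∂q = Znorm := by
  have h1 := (integrable_weight_and_integral_eq_one (q := q) hw hw0).2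
  have hwt : (fun y => wt y) = fun y => Znorm * w y := funext fun y => by rw [hwZ y]; field_simp
  rw [hwt, integral_const_mul, h1, mul_one]

omit [IsProbabilityMeasure q] in
/-- **THE LOWER CERTIFICATE**: `a ≤ E_q[min(w̃, B)] ⇒ a ≤ Z` (`B ≥ 0`). [ours] -/
theorem le_normaliser_of_le_proposal_mean (hw : Measurable w) (hw0 : ∀ y, 0 < w y)
    [IsProbabilityMeasure (q.withDensity fun y => ENNReal.ofReal (w y))] (hwZ : ∀ y, w y = wt y / Znorm)
    (hwt0 : ∀ y, 0 ≤ wt y) (hZ : 0 < Znorm) {B : ℝ} (hB : 0 ≤ B) {a : ℝ} (ha : a ≤ ∫ y, min (wt y) B ∂q) : a ≤ Znorm := by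
  have hwti : Integrable wt q := by
    have hwt' : (fun y => wt y) = fun y => Znorm * w y := funext fun y => by rw [hwZ y]; field_simp
    rw [show wt = fun y => Znorm * w y from hwt']
    exact (integrable_weight_and_integral_eq_one (q := q) hw hw0).1.const_mul Znorm
  exact ha.trans (integral_min_unnormalised_le_normaliser hwti hwt0 (integral_unnormalised_eq_normaliser hw hw0 hwZ hZ) hB)

end Bracket

/-! ## §2 The fully empirical every-weight Bernstein bar -/

section Replicas

variable {Ω' : Type*} {mΩ' : MeasurableSpace Ω'} {μ : Measure Ω'} [IsProbabilityMeasure μ]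
  {Z : ℕ → Ω' → (ℕ → Ω × Ω)} {wt : Ω → ℝ} {Znorm : ℝ}

/-- **THE FULLY EMPIRICAL EVERY-WEIGHT BERNSTEIN BAR ABOUT `π f`** (standard Borel `Ω`, every proposal law, every positive weight):
the bracket of the normaliser is certified from the two samples — `0 < a ≤ E_q[min(w̃, B)]` (proposals) and `0 < b ≤ E_π[min(1/w̃, B′)]`
(target samples) — and the remaining inputs by `ĉ ≤ E_q[min(1, b·w̃)]`, `t̂ ≥ q{M·a < w̃}`, `ŝ ≤ E_q[w̃·1{w̃ ≤ M·a}]` (proposals);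
then from `x` with `w̃(x) ≤ M·a` (`M ≥ 0`), `R ≥ 1` independent coupled pairs, window `N`, burn-in `k`, `σ² ≥ Var_{δ_xK^k} f > 0`, `ε ≥ 0`:
`P(|H̄_R − π f| ≥ ε + (c − a_f)(1 − ŝ·b + ρ̂^k)) ≤ 2·exp(−Rε²/(2(σ² + (c − a_f)ε/3))) + R·(t̂ + ρ̂^k)`, `ρ̂ = 1 − ĉ/max(1, M)`. [ours] -/
theorem crnLag_replicas_burnIn_bernstein_abs_target_twoSample [StandardBorelSpace Ω] [Nonempty Ω] [MeasurableSingletonClass Ω]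
    [MeasurableEq Ω] [Fact (Measurable w)] (hw0 : ∀ y, 0 < w y) [IsProbabilityMeasure (q.withDensity fun y => ENNReal.ofReal (w y))]
    (hwt : Measurable wt) (hwZ : ∀ y, w y = wt y / Znorm) (hwt0 : ∀ y, 0 ≤ wt y) (hZn : 0 < Znorm)
    {a B : ℝ} (ha0 : 0 < a) (hB : 0 ≤ B) (ha : a ≤ ∫ y, min (wt y) B ∂q)
    {b B' : ℝ} (hb0 : 0 < b) (hB' : 0 ≤ B') (hb : b ≤ ∫ y, min (wt y)⁻¹ B' ∂(q.withDensity fun y => ENNReal.ofReal (w y)))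
    (Khat : Kernel (Ω × Ω) (Ω × Ω)) [IsMarkovKernel Khat]
    (hK : ∀ z : Ω × Ω, Khat z = (q.prod (volume : Measure unitInterval)).map (fun p : Ω × unitInterval =>
      ((if (p.2 : ℝ) * w z.1 ≤ w p.1 then p.1 else z.1), (if (p.2 : ℝ) * w z.2 ≤ w p.1 then p.1 else z.2))))
    (x : Ω) {M : ℝ} (hM : 0 ≤ M) (hxM : wt x ≤ M * a) (ν : Measure (Ω × Ω)) [IsProbabilityMeasure ν]
    (hν : ν = (indepMH q w x).map fun y : Ω => (y, x)) {f : Ω → ℝ} (hf : Measurable f) {af c : ℝ} (haf : ∀ y, af ≤ f y)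
    (hc : ∀ y, f y ≤ c) (k N : ℕ) (hZm : ∀ j, Measurable (Z j))
    (hlaw : ∀ j, μ.map (Z j) = Kernel.trajMeasure (X := fun _ : ℕ => Ω × Ω) ν
      (fun n : ℕ => Khat.comap (fun h : (i : ↥(Finset.Iic n)) → Ω × Ω => h ⟨n, Finset.mem_Iic.2 le_rfl⟩)
        (measurable_pi_apply _)))
    (hind : iIndepFun Z μ) {σ2 : ℝ} (hσ : 0 < σ2)
    (hσk : variance f ((fun m : Measure Ω => m.bind (indepMH q w))^[k] (Measure.dirac x)) ≤ σ2)
    {ε : ℝ} (hε : 0 ≤ ε) {R : ℕ} (hR : 1 ≤ R) {chat that shat : ℝ}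
    (hchat : chat ≤ ∫ y, min 1 (b * wt y) ∂q) (hthat : q.real {y | M * a < wt y} ≤ that)
    (hshat : shat ≤ ∫ y, Set.indicator {y | wt y ≤ M * a} wt y ∂q) :
    μ.real {ω | ε + (c - af) * (ENNReal.ofReal (1 - shat * b) + (1 - ENNReal.ofReal chat / ENNReal.ofReal (max 1 M)) ^ k).toReal ≤
        |(R : ℝ)⁻¹ * ∑ j ∈ range R, (f ((Z j ω k).2) + ∑ n ∈ range N, (f ((Z j ω (k + n)).1) - f ((Z j ω (k + n)).2))) -
          ∫ y, f y ∂(q.withDensity fun y => ENNReal.ofReal (w y))|} ≤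
      2 * Real.exp (-(R * ε ^ 2) / (2 * (σ2 + (c - af) * ε / 3))) +
        R * (ENNReal.ofReal that + (1 - ENNReal.ofReal chat / ENNReal.ofReal (max 1 M)) ^ k).toReal := by
  have hw : Measurable w := Fact.out
  -- the bracket `[a, 1/b]` holds
  have hZloZ : a ≤ Znorm := le_normaliser_of_le_proposal_mean hw hw0 hwZ hwt0 hZn hB ha
  have hZhi : Znorm ≤ b⁻¹ := normaliser_le_inv_of_le_target_mean hw hw0 hwZ hwt0 hZn hB' hb0 hb
  have hchat' : chat ≤ ∫ y, min 1 (wt y / b⁻¹) ∂q := by simpa only [div_inv_eq_mul, mul_comm] using hchat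
  have h := crnLag_replicas_burnIn_bernstein_abs_target_of_estimates hw0 hwt hwZ hwt0 ha0 hZloZ hZhi Khat hK x hM hxM ν hν hf haf hc
    k N hZm hlaw hind hσ hσk hε hR hchat' hthat hshat
  simpa only [div_inv_eq_mul] using h

end Replicas

end Summit.Ventures.LatticeQCDFlow.Exactness
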